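import Literature.Analysis.FluidPDE.ClassicalLqRateEnergy
import HarnessLib

/-!
# Local energy classes up to the top time for classical `L^q` solutions: the range with absorption

Analysis/FluidPDE proofs file (theorems only; no definitions, no named facts) on the discharge
path of the named fact `Literature.Analysis.FluidPDE.chaeWolf2017_dss_typeI_decay`
(`ChaeWolfRemovingDSS.lean`; D. Chae, J. Wolf, arXiv:1610.09464, Thm. 1.1). It renders **Step 2**
of the printed proof (arXiv p. 5–6), the local energy bound (2.4c) *with the absorption of the
terms `II` and `III`*, which is what makes the step work for every `p ≥ 4`:

> "`II ≤ … ≤ C R^{…} ‖uϕ‖_{L^{q/(q−2)}(…; L^{p/(p−2)})} ‖u‖²_{L^∞(−λ²,−1;L^p)}`. In case `p ≥ 4`,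
> having `p/(p−2) ≤ 2`, with the help of Jensen's inequality … `≤ C R^{1/2} ‖uϕ‖_{L^∞(…;L²)}`
> and by Young's inequality `II ≤ (1/16)‖uϕ‖²_{L^∞(…;L²)} + C R ‖u‖⁴_{L^∞(−λ²,−1;L^p)}`."
> (and the same for `III` with the pressure (2.4b)).

In the language of the companion `ClassicalLqRateEnergy.lean` (rate `‖u(t)‖_{L^q} ≤ K₀(−t)^{−κ}`
on `(−T, 0)`): there the terms `II, III` were bounded by `‖u(t)‖_q³ ∼ (−t)^{−3κ}`, integrable only
for `3κ < 1` (`q < 9` for DSS solutions); here, for a cut-off `φ = χ²`, one factor `χ|u|` is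
kept in the energy `e(t) = ∫ χ²|u(t)|²` by Cauchy–Schwarz,
`|II| + |III| ≲ e(t)^{1/2} ‖u(t)‖_q²` (`q ≥ 4`), and `‖u(t)‖_q² ∼ (−t)^{−2κ}` is integrable as soon
as `2κ < 1` (every `q` for DSS solutions, `κ = (q−3)/(2q)`); the energy factor is absorbed through
`max_{[t₀,t]} e ≤ A + B (max e)^{1/2} ⇒ max e ≤ 2A + B²`.

* `abs_flux_cutoff_sq_le` — the slice bound with absorption;
* `exists_uniform_energy_bound_absorb` — the uniform bound up to `t = 0`;
* `IsClassicalNSSolutionOn.exists_energy_classes_of_rate_absorb` — **(2.4c)** on every cylinder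
  `Q_ρ(0, x₀)`, `ρ² < T`, under `2κ < 1` and `4 ≤ q`:
  `sup_{−ρ²<t<0} ∫_{B(x₀,ρ)}|u(t)|² < ∞`, `∫∫_{Q_ρ(0,x₀)} |∇u|² < ∞`.

## References

* D. Chae, J. Wolf, arXiv:1610.09464, §2 Step 2, (2.4c)–(2.4g) (p. 5–6). [ChaeWolf2017RemovingDSS]
-/

noncomputable section

open MeasureTheory TopologicalSpace Set Function Filter Metric
open _root_.Topology
open scoped Laplacian InnerProductSpace RealInnerProductSpace ENNReal NNReal ContDiff

namespace Literature.Analysis.FluidPDE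

namespace ChaeWolfEnergy

open PressureNormalisation PressureNormalisationL3

/-! ### Two more Hölder bounds on balls

(Cauchy–Schwarz on a ball is `integral_mul_le_sqrt_mul_sqrt` of `TaoEnergyLocalisationProofs`
with `μ := volume.restrict B`.) -/

section Slice

variable {q : ℝ} (x₀ : (EuclideanSpace ℝ (Fin 3))) (R : ℝ)

/-- **`∫_B ‖v‖⁴ ≤ |B|^{1−4/q} M⁴`** and integrability, for `‖v‖_{L^q} ≤ M`, `4 ≤ q`. [folklore] -/
theorem setIntegral_norm_four_le {v : (EuclideanSpace ℝ (Fin 3)) → (EuclideanSpace ℝ (Fin 3))}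
    (hv : Continuous v) (hq : 4 ≤ q) {M : ℝ≥0} (hM : eLpNorm v (ENNReal.ofReal q) volume ≤ M) :
    ∫ y in closedBall x₀ R, ‖v y‖ ^ 4 ≤
      ((volume : Measure (EuclideanSpace ℝ (Fin 3))).real (closedBall x₀ R)) ^ (1 - 4 / q) *
        (M : ℝ) ^ 4 := by
  have hq0 : 0 < q := by linarith
  have hq1 : (1 : ℝ≥0∞) ≤ ENNReal.ofReal (q / 4) := by
    rw [← ENNReal.ofReal_one]; exact ENNReal.ofReal_le_ofReal (by linarith)
  have e : eLpNorm (fun y => ‖v y‖ ^ (4 : ℝ)) (ENNReal.ofReal (q / 4)) volume =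
      eLpNorm v (ENNReal.ofReal (q / 4) * ENNReal.ofReal 4) volume ^ (4 : ℝ) :=
    eLpNorm_norm_rpow v (by norm_num)
  have e2 : ENNReal.ofReal (q / 4) * ENNReal.ofReal 4 = ENNReal.ofReal q := by
    rw [← ENNReal.ofReal_mul (by linarith)]; congr 1; ring
  have e3 : (fun y => ‖v y‖ ^ (4 : ℝ)) = fun y => ‖v y‖ ^ 4 := by
    funext y; exact_mod_cast Real.rpow_natCast ‖v y‖ 4
  rw [e2, e3] at e
  have hbound : eLpNorm (fun y => ‖v y‖ ^ 4) (ENNReal.ofReal (q / 4)) volume ≤ ((M ^ 4 : ℝ≥0) : ℝ≥0∞) := by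
    rw [e, ENNReal.coe_pow]
    have : eLpNorm v (ENNReal.ofReal q) volume ^ (4 : ℝ) = eLpNorm v (ENNReal.ofReal q) volume ^ 4 := by
      exact_mod_cast ENNReal.rpow_natCast _ 4
    rw [this]; gcongr
  have hmeas : AEStronglyMeasurable (fun y => ‖v y‖ ^ 4) volume := (hv.norm.pow 4).aestronglyMeasurable
  have hB := PressureNormalisation.setIntegral_norm_le_of_eLpNorm_le hmeas hq1 ENNReal.ofReal_ne_top
    hbound x₀ R
  rw [ENNReal.toReal_ofReal (by linarith), inv_div] at hB
  have e4 : ∫ y in closedBall x₀ R, ‖v y‖ ^ 4 = ∫ y in closedBall x₀ R, ‖‖v y‖ ^ 4‖ :=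
    integral_congr_ae (Eventually.of_forall fun y => (Real.norm_of_nonneg (by positivity)).symm)
  rw [e4]
  simpa using hB

/-- **`∫_B |Q|² ≤ |B|^{1−4/q} P²`** and integrability of `Q²` on `B`, for `Q ∈ L^{q/2}`,
`‖Q‖_{L^{q/2}} ≤ P`, `4 ≤ q`. [folklore] -/
theorem setIntegral_sq_le {Q : (EuclideanSpace ℝ (Fin 3)) → ℝ} (hq : 4 ≤ q)
    (hQ : MemLp Q (ENNReal.ofReal (q / 2)) volume) {P : ℝ≥0}
    (hP : eLpNorm Q (ENNReal.ofReal (q / 2)) volume ≤ P) :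
    IntegrableOn (fun y => Q y ^ 2) (closedBall x₀ R) volume ∧
    ∫ y in closedBall x₀ R, Q y ^ 2 ≤
      ((volume : Measure (EuclideanSpace ℝ (Fin 3))).real (closedBall x₀ R)) ^ (1 - 4 / q) *
        (P : ℝ) ^ 2 := by
  have hq0 : 0 < q := by linarith
  have hq1 : (1 : ℝ≥0∞) ≤ ENNReal.ofReal (q / 4) := by
    rw [← ENNReal.ofReal_one]; exact ENNReal.ofReal_le_ofReal (by linarith)
  have e : eLpNorm (fun y => ‖Q y‖ ^ (2 : ℝ)) (ENNReal.ofReal (q / 4)) volume =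
      eLpNorm Q (ENNReal.ofReal (q / 4) * ENNReal.ofReal 2) volume ^ (2 : ℝ) :=
    eLpNorm_norm_rpow Q (by norm_num)
  have e2 : ENNReal.ofReal (q / 4) * ENNReal.ofReal 2 = ENNReal.ofReal (q / 2) := by
    rw [← ENNReal.ofReal_mul (by linarith)]; congr 1; ring
  have e3 : (fun y => ‖Q y‖ ^ (2 : ℝ)) = fun y => Q y ^ 2 := by
    funext y; rw [Real.rpow_two, Real.norm_eq_abs, sq_abs]
  rw [e2, e3] at e
  have hmeas : AEStronglyMeasurable (fun y => Q y ^ 2) volume := by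
    have h1 : AEStronglyMeasurable (fun y => ‖Q y‖ ^ (2 : ℝ)) volume :=
      (Real.continuous_rpow_const (by norm_num : (0 : ℝ) ≤ 2)).comp_aestronglyMeasurable hQ.1.norm
    rwa [e3] at h1
  have hmem : MemLp (fun y => Q y ^ 2) (ENNReal.ofReal (q / 4)) volume := by
    refine ⟨hmeas, ?_⟩
    rw [e]
    exact ENNReal.rpow_lt_top_of_nonneg (by norm_num) hQ.eLpNorm_ne_top
  have hbound : eLpNorm (fun y => Q y ^ 2) (ENNReal.ofReal (q / 4)) volume ≤ ((P ^ 2 : ℝ≥0) : ℝ≥0∞) := by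
    rw [e, ENNReal.coe_pow]
    have : eLpNorm Q (ENNReal.ofReal (q / 2)) volume ^ (2 : ℝ) = eLpNorm Q (ENNReal.ofReal (q / 2)) volume ^ 2 := by
      exact_mod_cast ENNReal.rpow_natCast _ 2
    rw [this]; gcongr
  have hB := PressureNormalisation.setIntegral_norm_le_of_eLpNorm_le hmeas hq1 ENNReal.ofReal_ne_top
    hbound x₀ R
  rw [ENNReal.toReal_ofReal (by linarith), inv_div] at hB
  refine ⟨(hmem.locallyIntegrable hq1).integrableOn_isCompact (isCompact_closedBall x₀ R), ?_⟩
  have e4 : ∫ y in closedBall x₀ R, Q y ^ 2 = ∫ y in closedBall x₀ R, ‖Q y ^ 2‖ :=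
    integral_congr_ae (Eventually.of_forall fun y => (Real.norm_of_nonneg (sq_nonneg _)).symm)
  rw [e4]
  simpa using hB

end Slice

/-! ### The slice bound with absorption -/

section Flux

variable {q : ℝ}

/-- **The slice bound of the flux against `φ = χ²`, with one factor `χ|v|` kept**
(Chae–Wolf 2017, Step 2, case `p ≥ 4`). With `|Δ(χ²)| ≤ C_Δ`, `‖Dχ‖ ≤ C_D`, `supp χ ⊆ B̄(x₀, R)`,
`v ∈ C¹` divergence free with `‖v‖_q ≤ M`, `4 ≤ q`, pressure slice `pr = Q + C` a.e., `Q ∈ L^{q/2}`,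
`‖Q‖_{q/2} ≤ P`, and `e = ∫ χ²|v|²`, `V = |B̄(x₀,R)|`:
`|∫ (νΔ(χ²)|v|² + D(χ²)(v)|v|² + 2 pr D(χ²)(v))| ≤ νC_Δ V^{1−2/q}M² + e^{1/2} (2C_D V^{(1−4/q)/2} M² + 4C_D V^{(1−4/q)/2} P)`.
[cite: ChaeWolf2017RemovingDSS, §2 Step 2, bounds of II and III for p ≥ 4 (arXiv p. 5–6)] -/
theorem abs_flux_cutoff_sq_le {χ : (EuclideanSpace ℝ (Fin 3)) → ℝ} {x₀ : (EuclideanSpace ℝ (Fin 3))}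
    {R CΔ CD : ℝ} (hχ : ContDiff ℝ ∞ χ) (hχsupp : tsupport χ ⊆ closedBall x₀ R)
    (hΔ : ∀ x, |(Δ (fun y => χ y ^ 2)) x| ≤ CΔ) (hD : ∀ x, ‖fderiv ℝ χ x‖ ≤ CD)
    (hCΔ : 0 ≤ CΔ) (hCD : 0 ≤ CD)
    {v : (EuclideanSpace ℝ (Fin 3)) → (EuclideanSpace ℝ (Fin 3))} (hv : ContDiff ℝ 1 v)
    (hdiv : VectorCalculus.IsDivFree v) (hq : 4 ≤ q)
    {M : ℝ≥0} (hvM : eLpNorm v (ENNReal.ofReal q) volume ≤ M)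
    {pr : (EuclideanSpace ℝ (Fin 3)) → ℝ} (hpr : Continuous pr)
    {Q : (EuclideanSpace ℝ (Fin 3)) → ℝ} (hQ : MemLp Q (ENNReal.ofReal (q / 2)) volume)
    {P : ℝ≥0} (hQP : eLpNorm Q (ENNReal.ofReal (q / 2)) volume ≤ P) {C : ℝ}
    (hae : ∀ᵐ x ∂(volume : Measure (EuclideanSpace ℝ (Fin 3))), pr x = Q x + C)
    {ν : ℝ} (hν : 0 ≤ ν) :
    |∫ x, (ν * ((Δ (fun y => χ y ^ 2)) x * ‖v x‖ ^ 2) +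
        fderiv ℝ (fun y => χ y ^ 2) x (v x) * ‖v x‖ ^ 2 +
        2 * (pr x * fderiv ℝ (fun y => χ y ^ 2) x (v x)))| ≤
      ν * CΔ * (((volume : Measure (EuclideanSpace ℝ (Fin 3))).real (closedBall x₀ R)) ^ (1 - 2 / q) *
          (M : ℝ) ^ 2) +
        Real.sqrt (∫ x, χ x ^ 2 * ‖v x‖ ^ 2) *
          (2 * CD * (Real.sqrt (((volume : Measure (EuclideanSpace ℝ (Fin 3))).real (closedBall x₀ R)) ^
              (1 - 4 / q)) * (M : ℝ) ^ 2) +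
            4 * CD * (Real.sqrt (((volume : Measure (EuclideanSpace ℝ (Fin 3))).real (closedBall x₀ R)) ^
              (1 - 4 / q)) * (P : ℝ))) := by
  set V : ℝ := (volume : Measure (EuclideanSpace ℝ (Fin 3))).real (closedBall x₀ R) with hV
  set φ : (EuclideanSpace ℝ (Fin 3)) → ℝ := fun y => χ y ^ 2 with hφ
  set B := closedBall x₀ R with hB
  have hq2 : (2 : ℝ) ≤ q := by linarith
  have hq21 : (1 : ℝ≥0∞) ≤ ENNReal.ofReal (q / 2) := by
    rw [← ENNReal.ofReal_one]; exact ENNReal.ofReal_le_ofReal (by linarith)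
  -- regularity of the cut-offs
  have hχc : HasCompactSupport χ :=
    IsCompact.of_isClosed_subset (isCompact_closedBall x₀ R) (isClosed_tsupport _) hχsupp
  have hχ1 : ContDiff ℝ 1 χ := hχ.of_le (by norm_cast)
  have hφs : ContDiff ℝ ∞ φ := hχ.pow 2
  have hφ1 : ContDiff ℝ 1 φ := hφs.of_le (by norm_cast)
  have hφ2 : ContDiff ℝ 2 φ := hφs.of_le (by norm_cast)
  have hφsupp : tsupport φ ⊆ B := by
    refine subset_trans (closure_mono fun y hy => ?_) hχsupp
    intro h
    exact hy (by simp [hφ, h])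
  have hφc : HasCompactSupport φ :=
    IsCompact.of_isClosed_subset (isCompact_closedBall x₀ R) (isClosed_tsupport _) hφsupp
  have hDφ : ∀ x w, fderiv ℝ φ x w = 2 * χ x * fderiv ℝ χ x w := by
    intro x w
    have hd : DifferentiableAt ℝ χ x := (hχ1.differentiable one_ne_zero) x
    have e : φ = fun y => χ y * χ y := by funext y; simp [hφ, sq]
    rw [e, fderiv_fun_mul hd hd, FunLike.coe_add, Pi.add_apply, FunLike.coe_smul, Pi.smul_apply,
      smul_eq_mul]
    ring
  have hΔc : Continuous (Δ φ) := FluidPDE.continuous_laplacian hφ2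
  have hDχc : Continuous (fderiv ℝ χ) := hχ1.continuous_fderiv one_ne_zero
  have hDφc : Continuous (fderiv ℝ φ) := hφ1.continuous_fderiv one_ne_zero
  have hvc : Continuous v := hv.continuous
  have hχcont : Continuous χ := hχ.continuous
  have hout : ∀ y, R < dist y x₀ → y ∉ B := fun y hy hmem => by
    rw [hB, mem_closedBall] at hmem; linarith
  have hχ0 : ∀ y, R < dist y x₀ → χ y = 0 := fun y hy =>
    image_eq_zero_of_notMem_tsupport fun h => hout y hy (hχsupp h)
  have hΔ0 : ∀ y, R < dist y x₀ → (Δ φ) y = 0 := fun y hy =>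
    FluidPDE.laplacian_eq_zero_of_notMem_tsupport fun h => hout y hy (hφsupp h)
  have hDφ0 : ∀ y, R < dist y x₀ → fderiv ℝ φ y = 0 := fun y hy =>
    fderiv_of_notMem_tsupport ℝ fun h => hout y hy (hφsupp h)
  -- the energy `e = ∫ χ²|v|²` and `∫_B χ²|v|² ≤ e`
  set e : ℝ := ∫ x, χ x ^ 2 * ‖v x‖ ^ 2 with he
  have hei : Integrable (fun x => χ x ^ 2 * ‖v x‖ ^ 2) volume :=
    ((hχcont.pow 2).mul (hvc.norm.pow 2)).integrable_of_hasCompactSupport hφc.mul_right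
  have he0 : 0 ≤ e := integral_nonneg fun x => by positivity
  have heB : ∫ x in B, (|χ x| * ‖v x‖) ^ 2 ≤ e := by
    have e1 : ∫ x in B, (|χ x| * ‖v x‖) ^ 2 = ∫ x in B, χ x ^ 2 * ‖v x‖ ^ 2 :=
      integral_congr_ae (Eventually.of_forall fun x => by
        show (|χ x| * ‖v x‖) ^ 2 = χ x ^ 2 * ‖v x‖ ^ 2
        rw [mul_pow, sq_abs])
    rw [e1]
    exact setIntegral_le_integral hei (Eventually.of_forall fun x => by positivity)
  -- the three integrands
  set F₁ : (EuclideanSpace ℝ (Fin 3)) → ℝ := fun x => ν * ((Δ φ) x * ‖v x‖ ^ 2) with hF₁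
  set F₂ : (EuclideanSpace ℝ (Fin 3)) → ℝ := fun x => fderiv ℝ φ x (v x) * ‖v x‖ ^ 2 with hF₂
  set F₃ : (EuclideanSpace ℝ (Fin 3)) → ℝ := fun x => 2 * (pr x * fderiv ℝ φ x (v x)) with hF₃
  -- ## Term 1 (as without absorption)
  have hF₁m : AEStronglyMeasurable F₁ volume :=
    (continuous_const.mul (hΔc.mul (hvc.norm.pow 2))).aestronglyMeasurable
  have hF₁b : ∀ y, ‖F₁ y‖ ≤ ν * CΔ * ‖v y‖ ^ 2 := fun y => by
    show ‖ν * ((Δ φ) y * ‖v y‖ ^ 2)‖ ≤ _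
    rw [norm_mul, norm_mul, Real.norm_of_nonneg hν, norm_pow, norm_norm, Real.norm_eq_abs]
    calc ν * (|(Δ φ) y| * ‖v y‖ ^ 2) ≤ ν * (CΔ * ‖v y‖ ^ 2) := by gcongr; exact hΔ y
      _ = ν * CΔ * ‖v y‖ ^ 2 := by ring
  have hF₁0 : ∀ y, R < dist y x₀ → F₁ y = 0 := fun y hy => by simp [hF₁, hΔ0 y hy]
  obtain ⟨i1, b1⟩ := norm_integral_le_of_kernel_bound
    ((hvc.norm.pow 2).continuousOn.integrableOn_compact (isCompact_closedBall x₀ R)) hF₁m hF₁b hF₁0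
  have B1 : |∫ x, F₁ x| ≤ ν * CΔ * (V ^ (1 - 2 / q) * (M : ℝ) ^ 2) := by
    rw [← Real.norm_eq_abs]
    refine b1.trans (mul_le_mul_of_nonneg_left ?_ (by positivity))
    exact setIntegral_norm_sq_le x₀ R hvc hq2 hvM
  -- ## Term 2: `|Dφ(v)|v|²| ≤ 2 C_D (|χ||v|) |v|²`, Cauchy–Schwarz
  have hF₂m : AEStronglyMeasurable F₂ volume :=
    ((hDφc.clm_apply hvc).mul (hvc.norm.pow 2)).aestronglyMeasurable
  have hF₂b : ∀ y, ‖F₂ y‖ ≤ 2 * CD * ((|χ y| * ‖v y‖) * ‖v y‖ ^ 2) := fun y => by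
    show ‖fderiv ℝ φ y (v y) * ‖v y‖ ^ 2‖ ≤ _
    rw [norm_mul, norm_pow, norm_norm, hDφ y, Real.norm_eq_abs, abs_mul, abs_mul, abs_two]
    have h1 : |fderiv ℝ χ y (v y)| ≤ CD * ‖v y‖ := by
      rw [← Real.norm_eq_abs]
      exact (ContinuousLinearMap.le_opNorm _ _).trans (mul_le_mul_of_nonneg_right (hD y) (norm_nonneg _))
    calc 2 * |χ y| * |fderiv ℝ χ y (v y)| * ‖v y‖ ^ 2 ≤ 2 * |χ y| * (CD * ‖v y‖) * ‖v y‖ ^ 2 := by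
          gcongr
      _ = 2 * CD * ((|χ y| * ‖v y‖) * ‖v y‖ ^ 2) := by ring
  have hF₂0 : ∀ y, R < dist y x₀ → F₂ y = 0 := fun y hy => by simp [hF₂, hDφ0 y hy]
  have hH2 : IntegrableOn (fun y => (|χ y| * ‖v y‖) * ‖v y‖ ^ 2) B volume :=
    (((continuous_abs.comp hχcont).mul hvc.norm).mul (hvc.norm.pow 2)).continuousOn.integrableOn_compact
      (isCompact_closedBall x₀ R)
  obtain ⟨i2, b2⟩ := norm_integral_le_of_kernel_bound hH2 hF₂m hF₂b hF₂0
  have hCS2 : ∫ y in B, (|χ y| * ‖v y‖) * ‖v y‖ ^ 2 ≤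
      Real.sqrt e * (Real.sqrt (V ^ (1 - 4 / q)) * (M : ℝ) ^ 2) := by
    have h4 : IntegrableOn (fun y => (‖v y‖ ^ 2) ^ 2) B volume :=
      ((hvc.norm.pow 2).pow 2).continuousOn.integrableOn_compact (isCompact_closedBall x₀ R)
    have h2' : IntegrableOn (fun y => (|χ y| * ‖v y‖) ^ 2) B volume :=
      (((continuous_abs.comp hχcont).mul hvc.norm).pow 2).continuousOn.integrableOn_compact
        (isCompact_closedBall x₀ R)
    have hcs := integral_mul_le_sqrt_mul_sqrt (μ := volume.restrict B) (f := fun y => |χ y| * ‖v y‖)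
      (g := fun y => ‖v y‖ ^ 2) (fun y => by positivity) (fun y => by positivity)
      (((continuous_abs.comp hχcont).mul hvc.norm).aestronglyMeasurable)
      ((hvc.norm.pow 2).aestronglyMeasurable) h2' h4
    refine hcs.trans (mul_le_mul (Real.sqrt_le_sqrt heB) ?_ (Real.sqrt_nonneg _) (Real.sqrt_nonneg _))
    have e4 : ∫ y in B, (‖v y‖ ^ 2) ^ 2 = ∫ y in B, ‖v y‖ ^ 4 :=
      integral_congr_ae (Eventually.of_forall fun y => by ring)
    rw [e4]
    calc Real.sqrt (∫ y in B, ‖v y‖ ^ 4) ≤ Real.sqrt (V ^ (1 - 4 / q) * (M : ℝ) ^ 4) :=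
          Real.sqrt_le_sqrt (setIntegral_norm_four_le x₀ R hvc hq hvM)
      _ = Real.sqrt (V ^ (1 - 4 / q)) * (M : ℝ) ^ 2 := by
          rw [Real.sqrt_mul (by positivity), show ((M : ℝ) ^ 4) = ((M : ℝ) ^ 2) ^ 2 by ring,
            Real.sqrt_sq (by positivity)]
  have B2 : |∫ x, F₂ x| ≤ Real.sqrt e * (2 * CD * (Real.sqrt (V ^ (1 - 4 / q)) * (M : ℝ) ^ 2)) := by
    rw [← Real.norm_eq_abs]
    refine b2.trans ?_
    calc 2 * CD * ∫ y in B, |χ y| * ‖v y‖ * ‖v y‖ ^ 2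
        ≤ 2 * CD * (Real.sqrt e * (Real.sqrt (V ^ (1 - 4 / q)) * (M : ℝ) ^ 2)) :=
          mul_le_mul_of_nonneg_left hCS2 (by positivity)
      _ = _ := by ring
  -- ## Term 3: remove the constant, `|2 Q Dφ(v)| ≤ 4 C_D (|χ||v|) |Q|`, Cauchy–Schwarz
  have hQloc : LocallyIntegrable Q volume := hQ.locallyIntegrable hq21
  have hDv : Continuous fun x => fderiv ℝ φ x (v x) := hDφc.clm_apply hvc
  have hDvs : HasCompactSupport fun x => fderiv ℝ φ x (v x) := by
    refine HasCompactSupport.intro (isCompact_closedBall x₀ R) fun y hy => ?_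
    have hy' : R < dist y x₀ := by rwa [mem_closedBall, not_le] at hy
    simp [hDφ0 y hy']
  have iQD : Integrable (fun x => Q x * fderiv ℝ φ x (v x)) volume := by
    have hK : IsCompact (tsupport fun x => fderiv ℝ φ x (v x)) := hDvs
    have hon : IntegrableOn (fun x => Q x * fderiv ℝ φ x (v x)) (tsupport fun x => fderiv ℝ φ x (v x)) :=
      (hQloc.integrableOn_isCompact hK).mul_continuousOn hDv.continuousOn hK
    exact (integrableOn_iff_integrable_of_support_subset
      ((support_mul_subset_right _ _).trans (subset_tsupport _))).1 hon
  have iD : Integrable (fun x => fderiv ℝ φ x (v x)) volume := hDv.integrable_of_hasCompactSupport hDvs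
  have e3 : ∫ x, F₃ x = 2 * ∫ x, Q x * fderiv ℝ φ x (v x) := by
    have e1 : ∫ x, F₃ x = ∫ x, (2 * (Q x * fderiv ℝ φ x (v x)) + 2 * C * fderiv ℝ φ x (v x)) := by
      refine integral_congr_ae ?_
      filter_upwards [hae] with x hx
      simp only [hF₃, hx]; ring
    rw [e1, integral_add (iQD.const_mul 2) (iD.const_mul _), integral_const_mul, integral_const_mul,
      integral_fderiv_apply_eq_zero_of_isDivFree hv hdiv hφ1 hφc, mul_zero, add_zero]
  have hGm : AEStronglyMeasurable (fun x => Q x * fderiv ℝ φ x (v x)) volume := hQ.1.mul hDv.aestronglyMeasurable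
  have hGb : ∀ y, ‖Q y * fderiv ℝ φ y (v y)‖ ≤ 2 * CD * ((|χ y| * ‖v y‖) * |Q y|) := fun y => by
    rw [norm_mul, Real.norm_eq_abs, hDφ y, Real.norm_eq_abs, abs_mul, abs_mul, abs_two]
    have h1 : |fderiv ℝ χ y (v y)| ≤ CD * ‖v y‖ := by
      rw [← Real.norm_eq_abs]
      exact (ContinuousLinearMap.le_opNorm _ _).trans (mul_le_mul_of_nonneg_right (hD y) (norm_nonneg _))
    calc |Q y| * (2 * |χ y| * |fderiv ℝ χ y (v y)|) ≤ |Q y| * (2 * |χ y| * (CD * ‖v y‖)) := by gcongr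
      _ = 2 * CD * ((|χ y| * ‖v y‖) * |Q y|) := by ring
  have hG0 : ∀ y, R < dist y x₀ → Q y * fderiv ℝ φ y (v y) = 0 := fun y hy => by simp [hDφ0 y hy]
  have hH3 : IntegrableOn (fun y => (|χ y| * ‖v y‖) * |Q y|) B volume := by
    have h1 : IntegrableOn (fun y => ‖Q y‖) B volume := (hQloc.integrableOn_isCompact (isCompact_closedBall x₀ R)).norm
    have h2 := IntegrableOn.continuousOn_mul ((continuous_abs.comp hχcont).mul hvc.norm).continuousOn h1
      (isCompact_closedBall x₀ R)
    exact h2.congr_fun (fun y _ => by simp [Real.norm_eq_abs]) measurableSet_closedBall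
  obtain ⟨-, b3⟩ := norm_integral_le_of_kernel_bound hH3 hGm hGb hG0
  obtain ⟨iQ2, bQ2⟩ := setIntegral_sq_le x₀ R hq hQ hQP
  have hCS3 : ∫ y in B, (|χ y| * ‖v y‖) * |Q y| ≤ Real.sqrt e * (Real.sqrt (V ^ (1 - 4 / q)) * (P : ℝ)) := by
    have h2' : IntegrableOn (fun y => (|χ y| * ‖v y‖) ^ 2) B volume :=
      (((continuous_abs.comp hχcont).mul hvc.norm).pow 2).continuousOn.integrableOn_compact
        (isCompact_closedBall x₀ R)
    have hQ2' : IntegrableOn (fun y => |Q y| ^ 2) B volume := iQ2.congr_fun (fun y _ => by rw [sq_abs])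
      measurableSet_closedBall
    have hcs := integral_mul_le_sqrt_mul_sqrt (μ := volume.restrict B) (f := fun y => |χ y| * ‖v y‖)
      (g := fun y => |Q y|) (fun y => by positivity) (fun y => abs_nonneg _)
      (((continuous_abs.comp hχcont).mul hvc.norm).aestronglyMeasurable) (hQ.1.norm.restrict.congr
        (Eventually.of_forall fun y => by simp [Real.norm_eq_abs])) h2' hQ2'
    refine hcs.trans (mul_le_mul (Real.sqrt_le_sqrt heB) ?_ (Real.sqrt_nonneg _) (Real.sqrt_nonneg _))
    have e4 : ∫ y in B, |Q y| ^ 2 = ∫ y in B, Q y ^ 2 := integral_congr_ae (Eventually.of_forall fun y => sq_abs _)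
    rw [e4]
    calc Real.sqrt (∫ y in B, Q y ^ 2) ≤ Real.sqrt (V ^ (1 - 4 / q) * (P : ℝ) ^ 2) := Real.sqrt_le_sqrt bQ2
      _ = Real.sqrt (V ^ (1 - 4 / q)) * (P : ℝ) := by
          rw [Real.sqrt_mul (by positivity), Real.sqrt_sq P.coe_nonneg]
  have B3 : |∫ x, F₃ x| ≤ Real.sqrt e * (4 * CD * (Real.sqrt (V ^ (1 - 4 / q)) * (P : ℝ))) := by
    rw [e3, abs_mul, abs_two]
    have : |∫ x, Q x * fderiv ℝ φ x (v x)| ≤ 2 * CD * (Real.sqrt e * (Real.sqrt (V ^ (1 - 4 / q)) * (P : ℝ))) := by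
      rw [← Real.norm_eq_abs]
      exact b3.trans (mul_le_mul_of_nonneg_left hCS3 (by positivity))
    nlinarith [Real.sqrt_nonneg e, Real.sqrt_nonneg (V ^ (1 - 4 / q)), P.coe_nonneg]
  -- ## assembly
  have i3 : Integrable F₃ volume := by
    have : Integrable (fun x => 2 * (pr x * fderiv ℝ φ x (v x))) volume :=
      ((hpr.mul hDv).integrable_of_hasCompactSupport hDvs.mul_left).const_mul 2
    exact this
  have efold : ∫ x, (ν * ((Δ φ) x * ‖v x‖ ^ 2) + fderiv ℝ φ x (v x) * ‖v x‖ ^ 2 +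
      2 * (pr x * fderiv ℝ φ x (v x))) = ∫ x, (F₁ x + F₂ x + F₃ x) := by
    simp only [hF₁, hF₂, hF₃]
  have h12 : Integrable (fun x => F₁ x + F₂ x) volume := i1.add i2
  rw [efold, integral_add h12 i3, integral_add i1 i2]
  calc |(∫ x, F₁ x) + (∫ x, F₂ x) + ∫ x, F₃ x| ≤ |∫ x, F₁ x| + |∫ x, F₂ x| + |∫ x, F₃ x| := abs_add_three _ _ _
    _ ≤ ν * CΔ * (V ^ (1 - 2 / q) * (M : ℝ) ^ 2) +
        Real.sqrt e * (2 * CD * (Real.sqrt (V ^ (1 - 4 / q)) * (M : ℝ) ^ 2)) +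
        Real.sqrt e * (4 * CD * (Real.sqrt (V ^ (1 - 4 / q)) * (P : ℝ))) := add_le_add_three B1 B2 B3
    _ = _ := by ring

end Flux

/-! ### The uniform bound with absorption -/

section Energy

variable {u : ℝ → (EuclideanSpace ℝ (Fin 3)) → (EuclideanSpace ℝ (Fin 3))} {p : ℝ → (EuclideanSpace ℝ (Fin 3)) → ℝ}

/-- `x ≤ a + b√x` with `x ≥ 0` forces `x ≤ 2a + b²`. [folklore] -/
theorem le_of_le_add_mul_sqrt {x a b : ℝ} (hx : 0 ≤ x)
    (h : x ≤ a + b * Real.sqrt x) : x ≤ 2 * a + b ^ 2 := by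
  have hs := Real.sq_sqrt hx
  nlinarith [sq_nonneg (b - Real.sqrt x), Real.sqrt_nonneg x]

/-- `(−s)^{−2κ}` is interval integrable up to `0` for `2κ < 1`. [folklore] -/
theorem intervalIntegrable_rpow_neg_two {κ : ℝ} (hκ2 : 2 * κ < 1) (a : ℝ) :
    IntervalIntegrable (fun s : ℝ => (-s) ^ (-(2 * κ))) volume a 0 := by
  have h1 : IntervalIntegrable (fun x : ℝ => x ^ (-(2 * κ))) volume (-a) (-0) :=
    intervalIntegral.intervalIntegrable_rpow' (by linarith)
  have h2 := h1.comp_sub_left 0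
  simp only [zero_sub, neg_neg, neg_zero, sub_zero] at h2
  exact h2

/-- **The local energy stays bounded up to `t = 0`, with absorption** (Chae–Wolf 2017, Step 2,
`p ≥ 4`): under the rate `‖u(t)‖_{L^q} ≤ K₀ (−t)^{−κ}` on `(−T, 0)` with `2κ < 1`, `4 ≤ q`, for
the weight `χ²` of a smooth cut-off `χ` supported in `B̄(x₀, R)` and `−T < t₀ < 0`:
`∫ χ²|u(t)|² + 2∫_{t₀}^{t}∫ |∇u|²χ² ≤ Λ` for all `t ∈ [t₀, 0)`. The flux is majorised by
`(A + B e(s)^{1/2}) (−s)^{−2κ}` (`abs_flux_cutoff_sq_le`), and the maximum of `e` over `[t₀, t]`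
obeys `max e ≤ a + b (max e)^{1/2}`, whence `max e ≤ 2a + b²` independently of `t`. [cite: ChaeWolf2017RemovingDSS, §2 Step 2, (2.4f)–(2.4g)–(2.4c) (arXiv p. 5–6)] -/
theorem exists_uniform_energy_bound_absorb (hsol : IsClassicalNSSolutionOn (Iio 0) 1 0 u p)
    {q : ℝ} (hq : 4 ≤ q) {κ K₀ T : ℝ} (hκ : 0 ≤ κ) (hκ2 : 2 * κ < 1) (hK₀ : 0 ≤ K₀)
    (hLq : ∀ t ∈ Ioo (-T) 0, MemLp (u t) (ENNReal.ofReal q) volume)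
    (hrate : ∀ t ∈ Ioo (-T) 0,
      eLpNorm (u t) (ENNReal.ofReal q) volume ≤ ENNReal.ofReal (K₀ * (-t) ^ (-κ)))
    {χ : (EuclideanSpace ℝ (Fin 3)) → ℝ} {x₀ : (EuclideanSpace ℝ (Fin 3))} {R : ℝ}
    (hχ : ContDiff ℝ ∞ χ) (hχsupp : tsupport χ ⊆ closedBall x₀ R)
    {t₀ : ℝ} (ht₀ : -T < t₀) (ht₀0 : t₀ < 0) :
    ∃ Λ : ℝ, ∀ t ∈ Ico t₀ 0,
      (∫ x, χ x ^ 2 * ‖u t x‖ ^ 2) +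
        2 * ∫ s in t₀..t, ∫ x, frobeniusNormSq (fderiv ℝ (u s) x) * χ x ^ 2 ≤ Λ := by
  have hS : IsOpen (Iio (0 : ℝ)) := isOpen_Iio
  have hq2 : (2 : ℝ) < q := by linarith
  set φ : (EuclideanSpace ℝ (Fin 3)) → ℝ := fun y => χ y ^ 2 with hφ
  -- regularity of the cut-offs and bounds of their derivatives
  have hχc : HasCompactSupport χ :=
    IsCompact.of_isClosed_subset (isCompact_closedBall x₀ R) (isClosed_tsupport _) hχsupp
  have hχ1 : ContDiff ℝ 1 χ := hχ.of_le (by norm_cast)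
  have hφs : ContDiff ℝ ∞ φ := hχ.pow 2
  have hφ2 : ContDiff ℝ 2 φ := hφs.of_le (by norm_cast)
  have hφc : HasCompactSupport φ := hχc.comp_left (g := fun r : ℝ => r ^ 2) (by simp)
  have hΔc : Continuous (Δ φ) := FluidPDE.continuous_laplacian hφ2
  have hΔs : HasCompactSupport (Δ φ) := hφc.mono' fun x hx => by
    contrapose! hx
    simp [FluidPDE.laplacian_eq_zero_of_notMem_tsupport hx]
  obtain ⟨CΔ, hCΔ⟩ := hΔc.bounded_above_of_compact_support hΔs
  obtain ⟨CD, hCD⟩ := (hχ1.continuous_fderiv one_ne_zero).bounded_above_of_compact_support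
    (hχc.fderiv (𝕜 := ℝ))
  have hCΔ0 : 0 ≤ CΔ := (norm_nonneg _).trans (hCΔ 0)
  have hCD0 : 0 ≤ CD := (norm_nonneg _).trans (hCD 0)
  have hCΔ' : ∀ x, |(Δ φ) x| ≤ CΔ := fun x => by rw [← Real.norm_eq_abs]; exact hCΔ x
  -- the slice pressures
  obtain ⟨Cq, hQex⟩ := exists_rieszPressure_slice_of_rate hsol hq2 hκ hK₀ hLq hrate
  choose! Qt hQt hQtb hQteq Ct hCt using hQex
  -- the constants
  set V : ℝ := (volume : Measure (EuclideanSpace ℝ (Fin 3))).real (closedBall x₀ R) with hV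
  have hV0 : 0 ≤ V := measureReal_nonneg
  set A : ℝ := CΔ * V ^ (1 - 2 / q) * K₀ ^ 2 with hA
  set B : ℝ := 2 * CD * Real.sqrt (V ^ (1 - 4 / q)) * K₀ ^ 2 +
    4 * CD * Real.sqrt (V ^ (1 - 4 / q)) * (Cq : ℝ) * K₀ ^ 2 with hB
  have hA0 : 0 ≤ A := by positivity
  have hB0 : 0 ≤ B := by positivity
  -- energy, flux, dissipation
  set e : ℝ → ℝ := fun s => ∫ x, χ x ^ 2 * ‖u s x‖ ^ 2 with he
  have he0 : ∀ s, 0 ≤ e s := fun s => integral_nonneg fun x => by positivity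
  set Flux : ℝ → ℝ := fun s => ∫ x, ((1 : ℝ) * ((Δ φ) x * ‖u s x‖ ^ 2) +
    fderiv ℝ φ x (u s x) * ‖u s x‖ ^ 2 + 2 * (p s x * fderiv ℝ φ x (u s x))) with hFlux
  have hbound : ∀ s ∈ Ioo (-T) 0, ‖Flux s‖ ≤ (A + B * Real.sqrt (e s)) * (-s) ^ (-(2 * κ)) := by
    intro s hs
    have hs0 : 0 < -s := by linarith [hs.2]
    set M : ℝ≥0 := (K₀ * (-s) ^ (-κ)).toNNReal with hM
    have hMval : (M : ℝ) = K₀ * (-s) ^ (-κ) :=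
      Real.coe_toNNReal _ (mul_nonneg hK₀ (Real.rpow_nonneg hs0.le _))
    have hvM : eLpNorm (u s) (ENNReal.ofReal q) volume ≤ M := hrate s hs
    set P : ℝ≥0 := Cq * M ^ 2 with hP
    have hQP : eLpNorm (Qt s) (ENNReal.ofReal (q / 2)) volume ≤ P := by
      calc eLpNorm (Qt s) (ENNReal.ofReal (q / 2)) volume
          ≤ Cq * eLpNorm (u s) (ENNReal.ofReal q) volume ^ 2 := hQtb s hs
        _ ≤ Cq * (M : ℝ≥0∞) ^ 2 := by gcongr
        _ = (P : ℝ≥0∞) := by rw [hP]; push_cast; ring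
    have hs' : s ∈ Iio (0 : ℝ) := hs.2
    have key := abs_flux_cutoff_sq_le hχ hχsupp hCΔ' hCD hCΔ0 hCD0
      ((hsol.contDiff_velocity hs').of_le (by norm_cast)) (hsol.divFree s hs') hq hvM
      (hsol.contDiff_pressure hs').continuous (hQt s hs) hQP (hCt s hs) (le_of_lt one_pos)
    rw [Real.norm_eq_abs]
    refine key.trans (le_of_eq ?_)
    have i2 : (K₀ * (-s) ^ (-κ)) ^ 2 = K₀ ^ 2 * (-s) ^ (-(2 * κ)) := by
      rw [mul_pow, ← Real.rpow_natCast ((-s) ^ (-κ)) 2, ← Real.rpow_mul hs0.le]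
      congr 1; congr 1; push_cast; ring
    have hPval : (P : ℝ) = Cq * (K₀ * (-s) ^ (-κ)) ^ 2 := by
      rw [hP, NNReal.coe_mul, NNReal.coe_pow, hMval]
    rw [hMval, hPval, i2, hA, hB]
    ring
  -- continuity of the energy, the flux and the dissipation on `(−∞, 0)`
  have ce : ContinuousOn e (Iio 0) := fun s hs =>
    (hsol.hasDerivAt_integral_cutoff_norm_sq hS hφs hφc hs).continuousAt.continuousWithinAt
  have cF : ContinuousOn Flux (Iio 0) := hsol.continuousOn_integral_flux_cutoff hφs hφc
  -- the majorant integral `J = ∫_{t₀}^0 (−s)^{−2κ}`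
  have imaj : IntervalIntegrable (fun s : ℝ => (-s) ^ (-(2 * κ))) volume t₀ 0 :=
    intervalIntegrable_rpow_neg_two hκ2 t₀
  set J : ℝ := ∫ s in t₀..0, (-s) ^ (-(2 * κ)) with hJ
  have hJ0 : 0 ≤ J := intervalIntegral.integral_nonneg ht₀0.le fun s hs =>
    Real.rpow_nonneg (by linarith [hs.2]) _
  -- the bound
  set Λ₁ : ℝ := 2 * (e t₀ + A * J) + (B * J) ^ 2 with hΛ₁
  have hΛ₁0 : 0 ≤ Λ₁ := by positivity
  refine ⟨e t₀ + (A + B * Real.sqrt Λ₁) * J, fun t ht => ?_⟩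
  have ht0 : t < 0 := ht.2
  have hI : Icc t₀ t ⊆ Iio 0 := fun s hs => lt_of_le_of_lt hs.2 ht0
  -- the maximum of `e` over `[t₀, t]`
  obtain ⟨sm, hsm, hmax⟩ := (isCompact_Icc (a := t₀) (b := t)).exists_isMaxOn
    (nonempty_Icc.2 ht.1) (ce.mono hI)
  set Mx : ℝ := e sm with hMx
  have hMx0 : 0 ≤ Mx := he0 sm
  have heMx : ∀ σ ∈ Icc t₀ t, e σ ≤ Mx := fun σ hσ => hmax hσ
  -- the integrated identity on `[t₀, s]` for `s ∈ [t₀, t]`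
  have step : ∀ s ∈ Icc t₀ t, e s + 2 * ∫ σ in t₀..s, ∫ x, frobeniusNormSq (fderiv ℝ (u σ) x) * χ x ^ 2 ≤
      e t₀ + (A + B * Real.sqrt Mx) * J := by
    intro s hs
    have hs0 : s < 0 := lt_of_le_of_lt hs.2 ht0
    have hIs : Icc t₀ s ⊆ Iio 0 := fun σ hσ => lt_of_le_of_lt hσ.2 hs0
    have hIs' : uIcc t₀ s ⊆ Iio 0 := by rwa [uIcc_of_le hs.1]
    have hIT : Ioo t₀ s ⊆ Ioo (-T) 0 := fun σ hσ => ⟨ht₀.trans hσ.1, hσ.2.trans hs0⟩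
    have hid := hsol.local_energy_identity_cutoff hS hφs hφc hs.1 hIs
    have iF : IntervalIntegrable Flux volume t₀ s := (cF.mono hIs').intervalIntegrable
    have imaj' : IntervalIntegrable (fun σ : ℝ => (A + B * Real.sqrt Mx) * (-σ) ^ (-(2 * κ))) volume t₀ s := by
      refine (imaj.mono_set ?_).const_mul _
      rw [uIcc_of_le hs.1, uIcc_of_le ht₀0.le]
      exact Icc_subset_Icc le_rfl hs0.le
    have hF1 : ∫ σ in t₀..s, Flux σ ≤ ∫ σ in t₀..s, (A + B * Real.sqrt Mx) * (-σ) ^ (-(2 * κ)) := by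
      calc ∫ σ in t₀..s, Flux σ ≤ ‖∫ σ in t₀..s, Flux σ‖ := Real.le_norm_self _
        _ ≤ ∫ σ in t₀..s, ‖Flux σ‖ := intervalIntegral.norm_integral_le_integral_norm hs.1
        _ ≤ ∫ σ in t₀..s, (A + B * Real.sqrt Mx) * (-σ) ^ (-(2 * κ)) := by
            refine intervalIntegral.integral_mono_on_of_le_Ioo hs.1 iF.norm imaj' fun σ hσ => ?_
            refine (hbound σ (hIT hσ)).trans ?_
            have h1 : Real.sqrt (e σ) ≤ Real.sqrt Mx :=
              Real.sqrt_le_sqrt (heMx σ ⟨hσ.1.le, hσ.2.le.trans hs.2⟩)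
            have h2 : 0 ≤ (-σ) ^ (-(2 * κ)) := Real.rpow_nonneg (by linarith [hσ.2]) _
            have h3 : A + B * Real.sqrt (e σ) ≤ A + B * Real.sqrt Mx := by gcongr
            exact mul_le_mul_of_nonneg_right h3 h2
    have hF2 : ∫ σ in t₀..s, (A + B * Real.sqrt Mx) * (-σ) ^ (-(2 * κ)) ≤ (A + B * Real.sqrt Mx) * J := by
      rw [intervalIntegral.integral_const_mul]
      refine mul_le_mul_of_nonneg_left ?_ (by positivity)
      refine intervalIntegral.integral_mono_interval le_rfl hs.1 hs0.le ?_ imaj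
      exact (ae_restrict_iff' measurableSet_Ioc).2 (Eventually.of_forall fun σ hσ =>
        Real.rpow_nonneg (by linarith [hσ.2]) _)
    simp only [mul_one] at hid
    have : e s = ∫ x, χ x ^ 2 * ‖u s x‖ ^ 2 := rfl
    have : e t₀ = ∫ x, χ x ^ 2 * ‖u t₀ x‖ ^ 2 := rfl
    linarith
  -- the absorption: `Mx ≤ e t₀ + A J + (B J) √Mx`
  have hGnn : ∀ s ∈ Icc t₀ t, 0 ≤ ∫ σ in t₀..s, ∫ x, frobeniusNormSq (fderiv ℝ (u σ) x) * χ x ^ 2 :=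
    fun s hs => intervalIntegral.integral_nonneg hs.1 fun σ _ =>
      integral_nonneg fun x => mul_nonneg (frobeniusNormSq_nonneg _) (sq_nonneg _)
  have hMxle : Mx ≤ (e t₀ + A * J) + (B * J) * Real.sqrt Mx := by
    have h1 := step sm hsm
    have h2 := hGnn sm hsm
    rw [hMx]
    nlinarith
  have hMxΛ : Mx ≤ Λ₁ := le_of_le_add_mul_sqrt hMx0 hMxle
  -- conclusion at `t`
  have h1 := step t ⟨ht.1, le_rfl⟩
  have h2 : (A + B * Real.sqrt Mx) * J ≤ (A + B * Real.sqrt Λ₁) * J := by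
    gcongr
  have : e t = ∫ x, χ x ^ 2 * ‖u t x‖ ^ 2 := rfl
  linarith

/-- **Chae–Wolf 2017, (2.4c), with absorption**: for a classical solution of the unforced
Navier–Stokes system (`ν = 1`) on `ℝ³ × (−∞, 0)` with `u(t) ∈ L^q`, `4 ≤ q`, and the rate
`‖u(t)‖_{L^q} ≤ K₀(−t)^{−κ}` on `(−T, 0)` with `2κ < 1`, every backward cylinder `Q_ρ(0, x₀)`,
`ρ² < T`, carries the local energy classes **up to the top time**:
`sup_{−ρ² < t < 0} ∫_{B(x₀,ρ)} |u(t)|² < ∞` and `∫∫_{Q_ρ(0,x₀)} |∇u|² < ∞`. [cite: ChaeWolf2017RemovingDSS, §2 Step 2, (2.4c) and (2.4g) (arXiv p. 6)] -/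
theorem _root_.Literature.Analysis.FluidPDE.IsClassicalNSSolutionOn.exists_energy_classes_of_rate_absorb
    (hsol : IsClassicalNSSolutionOn (Iio 0) 1 0 u p)
    {q : ℝ} (hq : 4 ≤ q) {κ K₀ T : ℝ} (hκ : 0 ≤ κ) (hκ2 : 2 * κ < 1) (hK₀ : 0 ≤ K₀)
    (hLq : ∀ t ∈ Ioo (-T) 0, MemLp (u t) (ENNReal.ofReal q) volume)
    (hrate : ∀ t ∈ Ioo (-T) 0,
      eLpNorm (u t) (ENNReal.ofReal q) volume ≤ ENNReal.ofReal (K₀ * (-t) ^ (-κ)))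
    (x₀ : (EuclideanSpace ℝ (Fin 3))) {ρ : ℝ} (hρ : 0 < ρ) (hρT : ρ ^ 2 < T) :
    (∃ C : ℝ≥0, ∀ t ∈ Ioo (-ρ ^ 2) 0, ∫⁻ x in ball x₀ ρ, ‖u t x‖ₑ ^ 2 ≤ C) ∧
    ∫⁻ w in parabolicCylinder ρ ((0 : ℝ), x₀),
      ENNReal.ofReal (frobeniusNormSq (fderiv ℝ (u w.1) w.2)) < ⊤ := by
  have hS : IsOpen (Iio (0 : ℝ)) := isOpen_Iio
  -- the cut-off `χ` and the weight `χ²`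
  let χ : ContDiffBump x₀ := ⟨ρ, 2 * ρ, hρ, by linarith⟩
  have hχs : ContDiff ℝ ∞ χ := χ.contDiff
  have hχsupp : tsupport χ ⊆ closedBall x₀ (2 * ρ) := by rw [χ.tsupport_eq]
  have hφs : ContDiff ℝ ∞ (fun x : EuclideanSpace ℝ (Fin 3) => χ x ^ 2) := hχs.pow 2
  have hφc : HasCompactSupport (fun x : EuclideanSpace ℝ (Fin 3) => χ x ^ 2) :=
    χ.hasCompactSupport.comp_left (g := fun r : ℝ => r ^ 2) (by simp)
  have hφnn : ∀ x : EuclideanSpace ℝ (Fin 3), 0 ≤ χ x ^ 2 := fun x => sq_nonneg _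
  have hφ1 : ∀ x ∈ ball x₀ ρ, χ x ^ 2 = 1 := fun x hx => by
    rw [χ.one_of_mem_closedBall (ball_subset_closedBall hx), one_pow]
  -- the initial time `t₀`
  set t₀ : ℝ := -((T + ρ ^ 2) / 2) with ht₀
  have ht₀T : -T < t₀ := by rw [ht₀]; linarith
  have ht₀ρ : t₀ < -ρ ^ 2 := by rw [ht₀]; linarith
  have ht₀0 : t₀ < 0 := by rw [ht₀]; nlinarith
  obtain ⟨Λ, hΛ⟩ := exists_uniform_energy_bound_absorb hsol hq hκ hκ2 hK₀ hLq hrate hχs hχsupp ht₀T ht₀0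
  -- names for energy and dissipation
  set e : ℝ → ℝ := fun t => ∫ x, χ x ^ 2 * ‖u t x‖ ^ 2 with he
  set G : ℝ → ℝ := fun s => ∫ x, frobeniusNormSq (fderiv ℝ (u s) x) * χ x ^ 2 with hG
  have hGnn : ∀ s, 0 ≤ G s := fun s =>
    integral_nonneg fun x => mul_nonneg (frobeniusNormSq_nonneg _) (hφnn x)
  have henn : ∀ t, 0 ≤ e t := fun t => integral_nonneg fun x => mul_nonneg (hφnn x) (sq_nonneg _)
  have cG : ContinuousOn G (Iio 0) :=
    hsol.continuousOn_integral_dissipation_cutoff hS hφs.continuous hφc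
  have hIG : ∀ t ∈ Ico t₀ 0, 0 ≤ ∫ s in t₀..t, G s := fun t ht =>
    intervalIntegral.integral_nonneg ht.1 fun s _ => hGnn s
  have he_le : ∀ t ∈ Ico t₀ 0, e t ≤ Λ := fun t ht => by
    have := hΛ t ht; have := hIG t ht; linarith
  have hG_le : ∀ t ∈ Ico t₀ 0, ∫ s in t₀..t, G s ≤ Λ / 2 := fun t ht => by
    have := hΛ t ht; have := henn t; linarith
  have hΛ0 : 0 ≤ Λ := (henn t₀).trans (he_le t₀ ⟨le_rfl, ht₀0⟩)
  refine ⟨⟨Λ.toNNReal, fun t ht => ?_⟩, ?_⟩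
  · -- ## the `L^∞_t L²_x` class
    have ht' : t ∈ Ico t₀ 0 := ⟨(ht₀ρ.trans ht.1).le, ht.2⟩
    have huc : Continuous (u t) := (hsol.contDiff_velocity (ht.2 : t < 0)).continuous
    have hball : IntegrableOn (fun x => ‖u t x‖ ^ 2) (ball x₀ ρ) volume :=
      ((huc.norm.pow 2).continuousOn.integrableOn_compact (isCompact_closedBall x₀ ρ)).mono_set
        ball_subset_closedBall
    have hφu : Integrable (fun x => χ x ^ 2 * ‖u t x‖ ^ 2) volume :=
      (hφs.continuous.mul (huc.norm.pow 2)).integrable_of_hasCompactSupport hφc.mul_right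
    have h1 : ∫ x in ball x₀ ρ, ‖u t x‖ ^ 2 ≤ e t := by
      rw [he, ← integral_indicator measurableSet_ball]
      refine integral_mono (hball.integrable_indicator measurableSet_ball) hφu fun x => ?_
      by_cases hx : x ∈ ball x₀ ρ
      · rw [indicator_of_mem hx, hφ1 x hx, one_mul]
      · rw [indicator_of_notMem hx]; exact mul_nonneg (hφnn x) (sq_nonneg _)
    have h2 : ∫⁻ x in ball x₀ ρ, ‖u t x‖ₑ ^ 2 = ENNReal.ofReal (∫ x in ball x₀ ρ, ‖u t x‖ ^ 2) := by
      rw [ofReal_integral_eq_lintegral_ofReal hball (ae_of_all _ fun x => sq_nonneg _)]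
      refine lintegral_congr fun x => ?_
      rw [← ofReal_norm, ← ENNReal.ofReal_pow (norm_nonneg _)]
    rw [h2, ENNReal.ofReal]
    exact ENNReal.coe_le_coe.2 (Real.toNNReal_le_toNNReal (h1.trans (he_le t ht')))
  · -- ## the dissipation class
    set F : ℝ × (EuclideanSpace ℝ (Fin 3)) → ℝ≥0∞ := fun w =>
      ENNReal.ofReal (frobeniusNormSq (fderiv ℝ (u w.1) w.2)) with hF
    -- continuity of `F` below `t = 0`
    have hu1 : ContDiffOn ℝ 1 (uncurry u) (Iio 0 ×ˢ univ) := hsol.smooth_velocity.of_le (by norm_cast)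
    have cDu : ContinuousOn (fun z : ℝ × (EuclideanSpace ℝ (Fin 3)) => fderiv ℝ (u z.1) z.2)
        (Iio 0 ×ˢ univ) := continuousOn_fderiv_slice_of_contDiffOn hu1 hS.uniqueDiffOn
    have cF : ContinuousOn F (Iio 0 ×ˢ univ) :=
      ENNReal.continuous_ofReal.comp_continuousOn (continuous_frobeniusNormSq_clm.comp_continuousOn cDu)
    -- the bound on truncated cylinders
    have hcyl : ∀ t ∈ Ioo (-ρ ^ 2) 0,
        ∫⁻ w in Ioo (0 - ρ ^ 2) t ×ˢ ball x₀ ρ, F w ≤ ENNReal.ofReal (Λ / 2) := by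
      intro t ht
      have ht' : t ∈ Ico t₀ 0 := ⟨(ht₀ρ.trans ht.1).le, ht.2⟩
      have hsub : Ioo (0 - ρ ^ 2) t ×ˢ ball x₀ ρ ⊆ Iio (0 : ℝ) ×ˢ (univ : Set (EuclideanSpace ℝ (Fin 3))) :=
        prod_mono (fun s hs => (hs.2.trans ht.2 : s < 0)) (subset_univ _)
      have hFm : AEMeasurable F ((volume.restrict (Ioo (0 - ρ ^ 2) t)).prod
          (volume.restrict (ball x₀ ρ))) := by
        rw [Measure.prod_restrict]
        exact (cF.mono hsub).aemeasurable (measurableSet_Ioo.prod measurableSet_ball)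
      have hvol : (volume : Measure (ℝ × (EuclideanSpace ℝ (Fin 3)))) =
          (volume : Measure ℝ).prod (volume : Measure (EuclideanSpace ℝ (Fin 3))) := rfl
      rw [hvol, ← Measure.prod_restrict, lintegral_prod _ hFm]
      -- inner integral
      have hinner : ∀ s ∈ Ioo (0 - ρ ^ 2) t, ∫⁻ x in ball x₀ ρ, F (s, x) ≤ ENNReal.ofReal (G s) := by
        intro s hs
        have hs0 : s < 0 := hs.2.trans ht.2
        have cfs : Continuous fun x => frobeniusNormSq (fderiv ℝ (u s) x) :=
          continuous_frobeniusNormSq_clm.comp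
            (((hsol.contDiff_velocity hs0).of_le
              (by norm_cast : (1 : WithTop ℕ∞) ≤ ((⊤ : ℕ∞) : WithTop ℕ∞))).continuous_fderiv one_ne_zero)
        have hint : Integrable (fun x => frobeniusNormSq (fderiv ℝ (u s) x) * χ x ^ 2) volume :=
          (cfs.mul hφs.continuous).integrable_of_hasCompactSupport hφc.mul_left
        calc ∫⁻ x in ball x₀ ρ, F (s, x)
            = ∫⁻ x in ball x₀ ρ, ENNReal.ofReal (frobeniusNormSq (fderiv ℝ (u s) x) * χ x ^ 2) := by
              refine setLIntegral_congr_fun measurableSet_ball fun x hx => ?_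
              simp only [hF, hφ1 x hx, mul_one]
          _ ≤ ∫⁻ x, ENNReal.ofReal (frobeniusNormSq (fderiv ℝ (u s) x) * χ x ^ 2) :=
              lintegral_mono' Measure.restrict_le_self le_rfl
          _ = ENNReal.ofReal (G s) := by
              rw [hG, ofReal_integral_eq_lintegral_ofReal hint]
              exact ae_of_all _ fun x => mul_nonneg (frobeniusNormSq_nonneg _) (hφnn x)
      -- outer integral
      have hle : -ρ ^ 2 ≤ t := ht.1.le
      have hIcc : Icc (0 - ρ ^ 2) t ⊆ Iio 0 := fun s hs => lt_of_le_of_lt hs.2 ht.2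
      have iG : IntegrableOn G (Ioo (0 - ρ ^ 2) t) volume :=
        ((cG.mono hIcc).integrableOn_compact isCompact_Icc).mono_set Ioo_subset_Icc_self
      calc ∫⁻ s in Ioo (0 - ρ ^ 2) t, ∫⁻ x in ball x₀ ρ, F (s, x)
          ≤ ∫⁻ s in Ioo (0 - ρ ^ 2) t, ENNReal.ofReal (G s) :=
            setLIntegral_mono' measurableSet_Ioo fun s hs => hinner s hs
        _ = ENNReal.ofReal (∫ s in Ioo (0 - ρ ^ 2) t, G s) :=
            (ofReal_integral_eq_lintegral_ofReal iG (ae_of_all _ fun s => hGnn s)).symm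
        _ = ENNReal.ofReal (∫ s in (0 - ρ ^ 2)..t, G s) := by
            rw [intervalIntegral.integral_of_le (by linarith), integral_Ioc_eq_integral_Ioo]
        _ ≤ ENNReal.ofReal (∫ s in t₀..t, G s) := by
            refine ENNReal.ofReal_le_ofReal ?_
            refine intervalIntegral.integral_mono_interval (by linarith) (by linarith) le_rfl ?_ ?_
            · exact ae_of_all _ fun s => hGnn s
            · refine ((cG.mono ?_).intervalIntegrable)
              rw [uIcc_of_le ht'.1]
              exact fun s hs => lt_of_le_of_lt hs.2 ht.2
        _ ≤ ENNReal.ofReal (Λ / 2) := ENNReal.ofReal_le_ofReal (hG_le t ht')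
    -- exhaustion of the cylinder
    set tn : ℕ → ℝ := fun n => -(ρ ^ 2 / ((n : ℝ) + 2)) with htn
    have htn_mem : ∀ n, tn n ∈ Ioo (-ρ ^ 2) 0 := fun n => by
      have h2 : (0 : ℝ) < (n : ℝ) + 2 := by positivity
      have hρ2 : 0 < ρ ^ 2 := by positivity
      refine ⟨?_, ?_⟩
      · rw [htn]
        have : ρ ^ 2 / ((n : ℝ) + 2) < ρ ^ 2 := by
          rw [div_lt_iff₀ h2]; nlinarith
        linarith
      · rw [htn]; exact neg_neg_of_pos (div_pos hρ2 h2)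
    have hmono : Monotone fun n => Ioo (0 - ρ ^ 2) (tn n) ×ˢ ball x₀ ρ := by
      intro m n hmn
      refine prod_mono (Ioo_subset_Ioo le_rfl ?_) subset_rfl
      rw [htn]
      have h2 : (0 : ℝ) < (m : ℝ) + 2 := by positivity
      have : ρ ^ 2 / ((n : ℝ) + 2) ≤ ρ ^ 2 / ((m : ℝ) + 2) :=
        div_le_div_of_nonneg_left (by positivity) h2 (by exact_mod_cast Nat.add_le_add_right hmn 2)
      linarith
    have hunion : (⋃ n, Ioo (0 - ρ ^ 2) (tn n) ×ˢ ball x₀ ρ) = parabolicCylinder ρ ((0 : ℝ), x₀) := by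
      rw [parabolicCylinder, ← iUnion_prod_const]
      congr 1
      ext s
      simp only [mem_iUnion, mem_Ioo]
      constructor
      · rintro ⟨n, h1, h2⟩; exact ⟨h1, h2.trans (htn_mem n).2⟩
      · rintro ⟨h1, h2⟩
        have hs : 0 < -s := by linarith
        obtain ⟨n, hn⟩ := exists_nat_gt (ρ ^ 2 / -s)
        refine ⟨n, h1, ?_⟩
        rw [htn]
        have h2' : (0 : ℝ) < (n : ℝ) + 2 := by positivity
        have : ρ ^ 2 / ((n : ℝ) + 2) < -s := by
          rw [div_lt_iff₀ h2']
          rw [div_lt_iff₀ hs] at hn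
          nlinarith
        linarith
    rw [← hunion, setLIntegral_iUnion_of_directed F hmono.directed_le]
    refine lt_of_le_of_lt (iSup_le fun n => hcyl (tn n) (htn_mem n)) ENNReal.ofReal_lt_top


end Energy

end ChaeWolfEnergy

end Literature.Analysis.FluidPDE

end
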